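import Literature.Probability.Distributions.GaussianWickTheorem
import Literature.Probability.Distributions.GaussianCoordinateMoments
import Literature.Probability.Distributions.GaussianPoincare
import Mathlib.Probability.Distributions.Gaussian.HasGaussianLaw.Independence
import HarnessLib

/-!
# Route `LogConcaveChart` — toolkit for the support item `TransportCovarianceTransfer`
(stmt-QuantumFields-23668, child of the transport split of crux `QuadraticCovarianceComparison`,
stmt-QuantumFields-26240): **the Gaussian side — quadratic observables under `𝒩(0, I_n)`**

In the isotropic frame (`H₀ = 1`) the reference measure of the item is `γ = 𝒩(0, I_n)`, Mathlib's
`Measure.pi (fun _ => gaussianReal 0 1)` on `Fin n → ℝ`.  For the quadratic(+linear) observables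
`q_{H,b}(z) = zᵀHz + b·z` of the crux the Gaussian proxy `rC` is the EXACT `γ`-covariance:

* `isGaussianProcess_eval_pi_gaussianReal_one` — the coordinate process of `γ` is a centred Gaussian
  process (independent Gaussians are jointly Gaussian), so the tree's Wick theorem
  (`Literature.Probability.Distributions.GaussianWick.integral_prod_four`, `…_odd_eq_zero`) applies;
* `integral_eval_four_pi`, `integral_eval_three_pi` — Isserlis at orders 4 and 3;
* `integral_quadForm_pi` — `∫ zᵀHz dγ = tr H`; `integral_dotProduct_pi` — `∫ b·z dγ = 0`;
* `integral_quadForm_mul_quadForm_pi` — `∫ (zᵀHz)(zᵀGz) dγ = tr H · tr G + 2 tr(HG)` (`H, G` symmetric);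
  `integral_quadForm_mul_dotProduct_pi` — `∫ (zᵀHz)(c·z) dγ = 0`;
  `integral_dotProduct_mul_dotProduct_pi` — `∫ (b·z)(c·z) dγ = b·c`;
* `covariance_quadObs_pi` — **`Cov_γ(q_{H,b}, q_{G,c}) = 2 tr(HG) + b·c`**, i.e. the crux's `rC`
  (and `rV_f = 2 tr(H²) + |b|²`) at `H₀ = 1`.

HONEST SCOPE. Helper lemmas toward ONE support item of a sub-line (step (2) of its proof plan);
nothing here proves `TransportCovarianceTransfer`, `QuadraticCovarianceComparison`, the
`LogConcaveChart` thesis, rung R2a (`BalabanLadder.NT`) or any summit statement; the Yang–Mills mass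
gap is NOT proved.  Filed by ideator seat ym-idea-8 (generation 8, lens «dual» = transport side).
-/

namespace Summit.QuantumFields.YangMills.Cruxes.TransportCovarianceTransfer

open MeasureTheory ProbabilityTheory
open scoped NNReal ENNReal

variable {n : ℕ}

/-- The coordinate process of `𝒩(0, I_n) = ⊗ⁿ 𝒩(0,1)` is a Gaussian process (independent Gaussians
are jointly Gaussian). [folklore] -/
theorem isGaussianProcess_eval_pi_gaussianReal_one :
    IsGaussianProcess (fun (i : Fin n) (z : Fin n → ℝ) => z i)
      (Measure.pi fun _ : Fin n => gaussianReal 0 1) :=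
  ⟨fun I => iIndepFun.hasGaussianLaw
    (fun i : I => (measurePreserving_eval (fun _ : Fin n => gaussianReal 0 1) i.1).hasLaw.hasGaussianLaw)
    ((iIndepFun_pi (μ := fun _ : Fin n => gaussianReal 0 1) (X := fun _ x => x)
      fun _ => aemeasurable_id).precomp Subtype.val_injective)⟩

/-- `𝒩(0, I_n)` is centred: `∫ zᵢ dγ = 0`. [folklore] -/
theorem integral_eval_pi_gaussianReal_one (i : Fin n) :
    ∫ z, z i ∂(Measure.pi fun _ : Fin n => gaussianReal 0 1) = 0 := by
  rw [integral_eval]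
  exact integral_id_gaussianReal

/-- All products of coordinates are `γ`-integrable (orders 1–4 as used below). [folklore] -/
theorem integrable_eval_pi (i : Fin n) :
    Integrable (fun z : Fin n → ℝ => z i) (Measure.pi fun _ : Fin n => gaussianReal 0 1) := by
  have h := Literature.Probability.Distributions.GaussianWick.integrable_prod
    (isGaussianProcess_eval_pi_gaussianReal_one (n := n)) Finset.univ ![i]
  refine h.congr (ae_of_all _ fun z => ?_)
  simp

/-- `zᵢzⱼ ∈ L¹(γ)`. [folklore] -/
theorem integrable_eval_mul_eval_pi (i j : Fin n) :
    Integrable (fun z : Fin n → ℝ => z i * z j) (Measure.pi fun _ : Fin n => gaussianReal 0 1) :=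
  Literature.Probability.Distributions.integrable_eval_mul_eval_pi_gaussianReal 1 i j

/-- `zᵢzⱼz_k ∈ L¹(γ)`. [folklore] -/
theorem integrable_eval_three_pi (i j k : Fin n) :
    Integrable (fun z : Fin n → ℝ => z i * z j * z k) (Measure.pi fun _ : Fin n => gaussianReal 0 1) := by
  have h := Literature.Probability.Distributions.GaussianWick.integrable_prod
    (isGaussianProcess_eval_pi_gaussianReal_one (n := n)) Finset.univ ![i, j, k]
  refine h.congr (ae_of_all _ fun z => ?_)
  simp [Fin.prod_univ_three]

/-- `zᵢzⱼz_kz_l ∈ L¹(γ)`. [folklore] -/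
theorem integrable_eval_four_pi (i j k l : Fin n) :
    Integrable (fun z : Fin n → ℝ => z i * z j * z k * z l)
      (Measure.pi fun _ : Fin n => gaussianReal 0 1) := by
  have h := Literature.Probability.Distributions.GaussianWick.integrable_prod
    (isGaussianProcess_eval_pi_gaussianReal_one (n := n)) Finset.univ ![i, j, k, l]
  refine h.congr (ae_of_all _ fun z => ?_)
  simp [Fin.prod_univ_four]

/-- Two-point function `∫ zᵢzⱼ dγ = δᵢⱼ` (the tree's `integral_eval_mul_eval_pi_gaussianReal`). [folklore] -/
theorem integral_eval_mul_eval_pi (i j : Fin n) :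
    ∫ z, z i * z j ∂(Measure.pi fun _ : Fin n => gaussianReal 0 1) = if i = j then (1 : ℝ) else 0 := by
  rw [Literature.Probability.Distributions.integral_eval_mul_eval_pi_gaussianReal 1 i j, NNReal.coe_one]

/-- Odd moments vanish: `∫ zᵢzⱼz_k dγ = 0`. [folklore] -/
theorem integral_eval_three_pi (i j k : Fin n) :
    ∫ z, z i * z j * z k ∂(Measure.pi fun _ : Fin n => gaussianReal 0 1) = 0 := by
  have h := Literature.Probability.Distributions.GaussianWick.integral_prod_odd_eq_zero
    (isGaussianProcess_eval_pi_gaussianReal_one (n := n)) integral_eval_pi_gaussianReal_one 1 ![i, j, k]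
  have e : (fun z : Fin n → ℝ => ∏ l : Fin (2 * 1 + 1), z (![i, j, k] l)) = fun z => z i * z j * z k := by
    funext z
    simp [Fin.prod_univ_three]
  rw [e] at h
  exact h

/-- **Isserlis at order four** for `𝒩(0, I_n)`: `∫ zᵢzⱼz_kz_l dγ = δᵢⱼδ_kl + δᵢ_kδⱼ_l + δᵢ_lδⱼ_k`.
[folklore] -/
theorem integral_eval_four_pi (i j k l : Fin n) :
    ∫ z, z i * z j * z k * z l ∂(Measure.pi fun _ : Fin n => gaussianReal 0 1) =
      (if i = j then (1 : ℝ) else 0) * (if k = l then 1 else 0) +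
        (if i = k then (1 : ℝ) else 0) * (if j = l then 1 else 0) +
        (if i = l then (1 : ℝ) else 0) * (if j = k then 1 else 0) := by
  have h := Literature.Probability.Distributions.GaussianWick.integral_prod_four
    (isGaussianProcess_eval_pi_gaussianReal_one (n := n)) integral_eval_pi_gaussianReal_one ![i, j, k, l]
  simp only [Matrix.cons_val_zero, Matrix.cons_val_one] at h
  have h2 : (![i, j, k, l] : Fin 4 → Fin n) 2 = k := rfl
  have h3 : (![i, j, k, l] : Fin 4 → Fin n) 3 = l := rfl
  simp only [h2, h3, integral_eval_mul_eval_pi] at h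
  exact h

/-- `zᵀHz = ∑ᵢⱼ Hᵢⱼ zᵢzⱼ`. [folklore] -/
theorem quadForm_eq_sum (H : Matrix (Fin n) (Fin n) ℝ) (z : Fin n → ℝ) :
    z ⬝ᵥ H.mulVec z = ∑ i, ∑ j, H i j * (z i * z j) := by
  simp only [dotProduct, Matrix.mulVec, Finset.mul_sum]
  exact Finset.sum_congr rfl fun i _ => Finset.sum_congr rfl fun j _ => by ring

/-- `b·z = ∑ᵢ bᵢzᵢ`. [folklore] -/
theorem dotProduct_eq_sum (b z : Fin n → ℝ) : b ⬝ᵥ z = ∑ i, b i * z i := rfl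

/-- `zᵀHz ∈ L¹(γ)`. [folklore] -/
theorem integrable_quadForm_pi (H : Matrix (Fin n) (Fin n) ℝ) :
    Integrable (fun z : Fin n → ℝ => z ⬝ᵥ H.mulVec z) (Measure.pi fun _ : Fin n => gaussianReal 0 1) := by
  simp_rw [quadForm_eq_sum]
  exact integrable_finsetSum _ fun i _ => integrable_finsetSum _ fun j _ =>
    (integrable_eval_mul_eval_pi i j).const_mul _

/-- `b·z ∈ L¹(γ)`. [folklore] -/
theorem integrable_dotProduct_pi (b : Fin n → ℝ) :
    Integrable (fun z : Fin n → ℝ => b ⬝ᵥ z) (Measure.pi fun _ : Fin n => gaussianReal 0 1) := by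
  simp_rw [dotProduct_eq_sum]
  exact integrable_finsetSum _ fun i _ => (integrable_eval_pi i).const_mul _

/-- **`∫ zᵀHz dγ = tr H`.** [folklore] -/
theorem integral_quadForm_pi (H : Matrix (Fin n) (Fin n) ℝ) :
    ∫ z, z ⬝ᵥ H.mulVec z ∂(Measure.pi fun _ : Fin n => gaussianReal 0 1) = H.trace := by
  simp_rw [quadForm_eq_sum]
  rw [integral_finsetSum _ fun i _ => integrable_finsetSum _ fun j _ =>
    (integrable_eval_mul_eval_pi i j).const_mul _]
  simp_rw [integral_finsetSum _ fun j _ => (integrable_eval_mul_eval_pi _ j).const_mul _,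
    integral_const_mul, integral_eval_mul_eval_pi, mul_ite, mul_one, mul_zero, Finset.sum_ite_eq,
    Finset.mem_univ, if_true]
  simp [Matrix.trace]

/-- **`∫ b·z dγ = 0`.** [folklore] -/
theorem integral_dotProduct_pi (b : Fin n → ℝ) :
    ∫ z, b ⬝ᵥ z ∂(Measure.pi fun _ : Fin n => gaussianReal 0 1) = 0 := by
  simp_rw [dotProduct_eq_sum]
  rw [integral_finsetSum _ fun i _ => (integrable_eval_pi i).const_mul _]
  refine Finset.sum_eq_zero fun i _ => ?_
  rw [integral_const_mul, integral_eval_pi_gaussianReal_one, mul_zero]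

/-- `(zᵀHz)(zᵀGz) = ∑ᵢⱼₖₗ HᵢⱼG_kl zᵢzⱼz_kz_l`. [folklore] -/
theorem quadForm_mul_quadForm_eq_sum (H G : Matrix (Fin n) (Fin n) ℝ) (z : Fin n → ℝ) :
    (z ⬝ᵥ H.mulVec z) * (z ⬝ᵥ G.mulVec z) =
      ∑ i, ∑ j, ∑ k, ∑ l, H i j * G k l * (z i * z j * z k * z l) := by
  rw [quadForm_eq_sum H z, quadForm_eq_sum G z, Finset.sum_mul]
  refine Finset.sum_congr rfl fun i _ => ?_
  rw [Finset.sum_mul]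
  refine Finset.sum_congr rfl fun j _ => ?_
  rw [Finset.mul_sum]
  refine Finset.sum_congr rfl fun k _ => ?_
  rw [Finset.mul_sum]
  exact Finset.sum_congr rfl fun l _ => by ring

/-- `(zᵀHz)(zᵀGz) ∈ L¹(γ)`. [folklore] -/
theorem integrable_quadForm_mul_quadForm_pi (H G : Matrix (Fin n) (Fin n) ℝ) :
    Integrable (fun z : Fin n → ℝ => (z ⬝ᵥ H.mulVec z) * (z ⬝ᵥ G.mulVec z))
      (Measure.pi fun _ : Fin n => gaussianReal 0 1) := by
  simp_rw [quadForm_mul_quadForm_eq_sum]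
  exact integrable_finsetSum _ fun i _ => integrable_finsetSum _ fun j _ =>
    integrable_finsetSum _ fun k _ => integrable_finsetSum _ fun l _ =>
      (integrable_eval_four_pi i j k l).const_mul _

/-- **`∫ (zᵀHz)(zᵀGz) dγ = tr H · tr G + 2 tr(HG)`** for symmetric `G` (Isserlis). [folklore] -/
theorem integral_quadForm_mul_quadForm_pi (H G : Matrix (Fin n) (Fin n) ℝ) (hG : G.IsSymm) :
    ∫ z, (z ⬝ᵥ H.mulVec z) * (z ⬝ᵥ G.mulVec z) ∂(Measure.pi fun _ : Fin n => gaussianReal 0 1) =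
      H.trace * G.trace + 2 * (H * G).trace := by
  simp_rw [quadForm_mul_quadForm_eq_sum]
  rw [integral_finsetSum _ fun i _ => integrable_finsetSum _ fun j _ =>
    integrable_finsetSum _ fun k _ => integrable_finsetSum _ fun l _ =>
      (integrable_eval_four_pi i j k l).const_mul _]
  simp_rw [integral_finsetSum _ fun j _ => integrable_finsetSum _ fun k _ =>
      integrable_finsetSum _ fun l _ => (integrable_eval_four_pi _ j k l).const_mul _,
    integral_finsetSum _ fun k _ => integrable_finsetSum _ fun l _ =>
      (integrable_eval_four_pi _ _ k l).const_mul _,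
    integral_finsetSum _ fun l _ => (integrable_eval_four_pi _ _ _ l).const_mul _,
    integral_const_mul, integral_eval_four_pi]
  -- split into the three pairings
  have e : ∀ i j k l : Fin n, H i j * G k l *
      ((if i = j then (1 : ℝ) else 0) * (if k = l then 1 else 0) +
        (if i = k then (1 : ℝ) else 0) * (if j = l then 1 else 0) +
        (if i = l then (1 : ℝ) else 0) * (if j = k then 1 else 0)) =
      (if i = j then (1 : ℝ) else 0) * (if k = l then 1 else 0) * (H i j * G k l) +
        (if i = k then (1 : ℝ) else 0) * (if j = l then 1 else 0) * (H i j * G k l) +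
        (if i = l then (1 : ℝ) else 0) * (if j = k then 1 else 0) * (H i j * G k l) := by
    intro i j k l; ring
  simp_rw [e, Finset.sum_add_distrib]
  rw [Literature.Probability.Distributions.sum_four_delta_fst (fun i j k l => H i j * G k l),
    Literature.Probability.Distributions.sum_four_delta_snd (fun i j k l => H i j * G k l),
    Literature.Probability.Distributions.sum_four_delta_trd (fun i j k l => H i j * G k l)]
  -- identify traces
  have t1 : ∑ i, ∑ k, H i i * G k k = H.trace * G.trace := by
    simp only [Matrix.trace, Matrix.diag_apply, Finset.sum_mul_sum]
  have t2 : ∑ i, ∑ j, H i j * G i j = (H * G).trace := by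
    simp only [Matrix.trace, Matrix.diag_apply, Matrix.mul_apply]
    refine Finset.sum_congr rfl fun i _ => Finset.sum_congr rfl fun j _ => ?_
    rw [hG.apply j i]
  have t3 : ∑ i, ∑ j, H i j * G j i = (H * G).trace := by
    simp only [Matrix.trace, Matrix.diag_apply, Matrix.mul_apply]
  rw [t1, t2, t3]
  ring

/-- `(zᵀHz)(c·z) ∈ L¹(γ)` and **`∫ (zᵀHz)(c·z) dγ = 0`** (odd moments). [folklore] -/
theorem integral_quadForm_mul_dotProduct_pi (H : Matrix (Fin n) (Fin n) ℝ) (c : Fin n → ℝ) :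
    Integrable (fun z : Fin n → ℝ => (z ⬝ᵥ H.mulVec z) * (c ⬝ᵥ z))
        (Measure.pi fun _ : Fin n => gaussianReal 0 1) ∧
      ∫ z, (z ⬝ᵥ H.mulVec z) * (c ⬝ᵥ z) ∂(Measure.pi fun _ : Fin n => gaussianReal 0 1) = 0 := by
  have e : ∀ z : Fin n → ℝ, (z ⬝ᵥ H.mulVec z) * (c ⬝ᵥ z) =
      ∑ i, ∑ j, ∑ k, H i j * c k * (z i * z j * z k) := by
    intro z
    rw [quadForm_eq_sum H z, dotProduct_eq_sum, Finset.sum_mul]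
    refine Finset.sum_congr rfl fun i _ => ?_
    rw [Finset.sum_mul]
    refine Finset.sum_congr rfl fun j _ => ?_
    rw [Finset.mul_sum]
    exact Finset.sum_congr rfl fun k _ => by ring
  simp_rw [e]
  refine ⟨integrable_finsetSum _ fun i _ => integrable_finsetSum _ fun j _ =>
    integrable_finsetSum _ fun k _ => (integrable_eval_three_pi i j k).const_mul _, ?_⟩
  rw [integral_finsetSum _ fun i _ => integrable_finsetSum _ fun j _ =>
    integrable_finsetSum _ fun k _ => (integrable_eval_three_pi i j k).const_mul _]
  refine Finset.sum_eq_zero fun i _ => ?_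
  rw [integral_finsetSum _ fun j _ => integrable_finsetSum _ fun k _ =>
    (integrable_eval_three_pi i j k).const_mul _]
  refine Finset.sum_eq_zero fun j _ => ?_
  rw [integral_finsetSum _ fun k _ => (integrable_eval_three_pi i j k).const_mul _]
  refine Finset.sum_eq_zero fun k _ => ?_
  rw [integral_const_mul, integral_eval_three_pi, mul_zero]

/-- `(b·z)(c·z) ∈ L¹(γ)` and **`∫ (b·z)(c·z) dγ = b·c`**. [folklore] -/
theorem integral_dotProduct_mul_dotProduct_pi (b c : Fin n → ℝ) :
    Integrable (fun z : Fin n → ℝ => (b ⬝ᵥ z) * (c ⬝ᵥ z))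
        (Measure.pi fun _ : Fin n => gaussianReal 0 1) ∧
      ∫ z, (b ⬝ᵥ z) * (c ⬝ᵥ z) ∂(Measure.pi fun _ : Fin n => gaussianReal 0 1) = b ⬝ᵥ c := by
  have e : ∀ z : Fin n → ℝ, (b ⬝ᵥ z) * (c ⬝ᵥ z) = ∑ i, ∑ j, b i * c j * (z i * z j) := by
    intro z
    rw [dotProduct_eq_sum, dotProduct_eq_sum, Finset.sum_mul]
    refine Finset.sum_congr rfl fun i _ => ?_
    rw [Finset.mul_sum]
    exact Finset.sum_congr rfl fun j _ => by ring
  simp_rw [e]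
  refine ⟨integrable_finsetSum _ fun i _ => integrable_finsetSum _ fun j _ =>
    (integrable_eval_mul_eval_pi i j).const_mul _, ?_⟩
  rw [integral_finsetSum _ fun i _ => integrable_finsetSum _ fun j _ =>
    (integrable_eval_mul_eval_pi i j).const_mul _]
  simp_rw [integral_finsetSum _ fun j _ => (integrable_eval_mul_eval_pi _ j).const_mul _,
    integral_const_mul, integral_eval_mul_eval_pi, mul_ite, mul_one, mul_zero, Finset.sum_ite_eq,
    Finset.mem_univ, if_true]
  rfl

/-- **The Gaussian proxy is exact at `H₀ = 1`:** for symmetric `H, G` and any `b, c`,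
`∫ q_{H,b} q_{G,c} dγ − (∫ q_{H,b} dγ)(∫ q_{G,c} dγ) = 2 tr(HG) + b·c`, where
`q_{H,b}(z) = zᵀHz + b·z` — the quantity `rC` of crux `QuadraticCovarianceComparison` in the isotropic
frame (and `rV = 2 tr(H²) + |b|²` for `G = H`, `c = b`). [folklore] -/
theorem covariance_quadObs_pi (H G : Matrix (Fin n) (Fin n) ℝ) (hG : G.IsSymm)
    (b c : Fin n → ℝ) :
    ∫ z, (z ⬝ᵥ H.mulVec z + b ⬝ᵥ z) * (z ⬝ᵥ G.mulVec z + c ⬝ᵥ z)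
          ∂(Measure.pi fun _ : Fin n => gaussianReal 0 1) -
        (∫ z, z ⬝ᵥ H.mulVec z + b ⬝ᵥ z ∂(Measure.pi fun _ : Fin n => gaussianReal 0 1)) *
          (∫ z, z ⬝ᵥ G.mulVec z + c ⬝ᵥ z ∂(Measure.pi fun _ : Fin n => gaussianReal 0 1)) =
      2 * (H * G).trace + b ⬝ᵥ c := by
  set γ : Measure (Fin n → ℝ) := Measure.pi fun _ : Fin n => gaussianReal 0 1 with hγ
  obtain ⟨iHc, hHc⟩ := integral_quadForm_mul_dotProduct_pi (n := n) H c
  obtain ⟨iGb, hGb⟩ := integral_quadForm_mul_dotProduct_pi (n := n) G b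
  obtain ⟨ibc, hbc⟩ := integral_dotProduct_mul_dotProduct_pi (n := n) b c
  have iHG := integrable_quadForm_mul_quadForm_pi (n := n) H G
  rw [← hγ] at iHc hHc iGb hGb ibc hbc iHG
  have e : ∀ z : Fin n → ℝ, (z ⬝ᵥ H.mulVec z + b ⬝ᵥ z) * (z ⬝ᵥ G.mulVec z + c ⬝ᵥ z) =
      (z ⬝ᵥ H.mulVec z) * (z ⬝ᵥ G.mulVec z) + (z ⬝ᵥ H.mulVec z) * (c ⬝ᵥ z) +
        ((z ⬝ᵥ G.mulVec z) * (b ⬝ᵥ z) + (b ⬝ᵥ z) * (c ⬝ᵥ z)) := by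
    intro z; ring
  simp_rw [e]
  have i1 : Integrable (fun z : Fin n → ℝ =>
      (z ⬝ᵥ H.mulVec z) * (z ⬝ᵥ G.mulVec z) + (z ⬝ᵥ H.mulVec z) * (c ⬝ᵥ z)) γ := iHG.add iHc
  have i2 : Integrable (fun z : Fin n → ℝ =>
      (z ⬝ᵥ G.mulVec z) * (b ⬝ᵥ z) + (b ⬝ᵥ z) * (c ⬝ᵥ z)) γ := iGb.add ibc
  rw [integral_add i1 i2, integral_add iHG iHc, integral_add iGb ibc,
    integral_quadForm_mul_quadForm_pi H G hG, hHc, hGb, hbc,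
    integral_add (integrable_quadForm_pi H) (integrable_dotProduct_pi b),
    integral_add (integrable_quadForm_pi G) (integrable_dotProduct_pi c),
    integral_quadForm_pi, integral_quadForm_pi, integral_dotProduct_pi, integral_dotProduct_pi]
  ring

end Summit.QuantumFields.YangMills.Cruxes.TransportCovarianceTransfer
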